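import Summits.CriticalPhenomena.CardyFormulaZ2.Theorems.CardyBondTriangularSwitchingReduction
import Literature.Probability.Percolation.ChayesLeiHex

/-!
# Route CardyBondTriangular — the switching reduction: input formats, the sandwich, the Chayes–Lei case

Companion of `CardyBondTriangularSwitchingReduction` (support of the informal route item
`SwitchingReduction`, stmt-CriticalPhenomena-5004). Three additions to the generic assembly
`exists_isSeparatingData_of_approxSwitching`:

* **Input formats.** The compact-set hypotheses (12), (14≈) and the estimate of p. 198 from the
  quantitative formats in which percolation estimates are naturally proved, uniformly over a
  family of discrete approximations `G_δ` (Bollobás–Riordan, *Percolation* (2006), Ch. 7): (12)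
  from a three-arm bound `|h(w, z)| ≤ A (δ/a)^α` at triangles whose centre is `≥ a` away from one
  discrete arc (`approxSwitching_small_of_armBound`, using (35) p. 197 and the closeness of the
  arcs); (14≈) from a colour-switching defect `η(a, δ) = o(δ)` at triangles `≥ a` away from all
  three discrete arcs (`approxSwitching_defect_of_rate`: a compact `K ⊆ Ω` stays `2a` away from
  `∂Ω`); the qualitative estimate of p. 198 from the printed `2 (3γ/(c/2))^α`
  (`approxSwitching_equi_of_dualPath`).
* **The sandwich** ((19) p. 184 with (40) at `z = P₄`, p. 203): two such systems of separating
  data and triangles `z∓_δ → d'` with `F⁻¹(z⁻_δ) - e(δ) ≤ Q(δ) ≤ F⁺¹(z⁺_δ) + e(δ)` give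
  LITERALLY the datum-wise hypothesis of the route item `SeparatingDataToCardy`
  (`exists_separatingData_sandwich`), for an arbitrary crossing-probability function `Q` (for the
  route: the crude bond-𝕋 crossing probability at mesh `δ/√3`).
* **The Chayes–Lei case** (`exists_isSeparatingData_clSepProb_of_approxSwitching`): for a hexagon
  model `M` on the sites of `𝕋` (Chayes–Lei 2007 §2.1–2.3; `clHexPercolation M`, for bond-𝕋
  `M = ChayesLeiHexPercolation.triBondCritical`) and the Bollobás–Riordan separating
  probabilities `clSepProb`, `clSepDiffProb` of the 3-marked domains `(G δ).dropLast`, (10) is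
  `clSepProb_sub_clSepProb` and `0 ≤ f ≤ 1` holds, so what remains is exactly: the three-arm
  smallness (12), the mesoscopic colour-switching defect (14≈) = the route's crux
  `MesoscopicColourSwitching` in per-face form, the estimate of p. 198 and the boundary values
  of pp. 200–201 — the percolation inputs named by the informal item.

## References

* B. Bollobás, O. Riordan, *Percolation*, Cambridge University Press (2006), Ch. 7: (12), (14)
  p. 181, (19) p. 184, (35) p. 197, p. 198, (40) p. 201, p. 203.
* L. Chayes, H. K. Lei, *Cardy's formula for certain models of the bond-triangular type*,
  Rev. Math. Phys. 19 (2007) 511–565, §2.1–2.3.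
-/

noncomputable section

namespace Summit.CriticalPhenomena.CardyFormulaZ2.Theorems

open Set Filter Topology Metric
open Literature.Probability.Percolation Literature.Probability.RandomPlanarGeometry
open Literature.Probability.RandomPlanarGeometry.MarkedDomain
open Literature.Probability.LatticeModels

/-! ### From the quantitative percolation formats to the compact-set hypotheses -/

/-- **Eventually, the faces with centre in a compact `K ⊆ Ω` are triangles of `G_δ`** (p. 199,
from the filling of the `κ`-thickening of `K`). [cite: BollobasRiordan2006, Ch. 7 p. 199] -/
theorem eventually_mem_faces_of_isDiscreteApprox {R : ConformalRectangle}
    {G : ℝ → TriMarkedDomain 4} (hG : IsDiscreteApprox R G) {K : Set ℂ} (hK : IsCompact K)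
    (hKΩ : K ⊆ R.carrier) :
    ∀ᶠ δ : ℝ in 𝓝[>] 0, ∀ w : HexVertex, (δ : ℂ) * hexCenter w ∈ K → w ∈ (G δ).faces := by
  obtain ⟨κ, hκ, hK'⟩ := hK.exists_cthickening_subset_open R.isOpen hKΩ
  have hfill := hG.fill (cthickening κ K) hK.cthickening hK'
  have hsmall : ∀ᶠ δ in 𝓝[>] (0 : ℝ), δ ∈ Ioc 0 κ := Ioc_mem_nhdsGT hκ
  filter_upwards [hfill, hsmall] with δ hfill hδ w hwK
  refine ((G δ).mem_faces).2 fun v hv => hfill v ?_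
  refine mem_cthickening_of_dist_le _ _ _ _ hwK ?_
  exact (dist_triMeshPoint_hexCenter_le hv δ).trans (by rw [abs_of_pos hδ.1]; exact hδ.2)

/-- **Eventually, the points of a compact `K ⊆ Ω` keep a fixed distance `a > 0` from the three
discrete arcs** of `(G δ).dropLast` (they keep distance `2a` from `∂Ω ⊇ Aᵢ`, and the discrete
arcs are `o(1)`-close to the continuum ones, (18)/(31)). [cite: BollobasRiordan2006, Ch. 7 (31) p. 196] -/
theorem eventually_le_infDist_arcPts_of_isDiscreteApprox {R : ConformalRectangle}
    {G : ℝ → TriMarkedDomain 4} (hG : IsDiscreteApprox R G) {K : Set ℂ} (hK : IsCompact K)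
    (hKΩ : K ⊆ R.carrier) :
    ∃ a > (0 : ℝ), ∀ᶠ δ : ℝ in 𝓝[>] 0, ∀ z ∈ K, ∀ j : Fin 3,
      a ≤ infDist z ((G δ).dropLast.arcPts δ j) := by
  rcases K.eq_empty_or_nonempty with rfl | hne
  · exact ⟨1, one_pos, Eventually.of_forall fun δ z hz => (Set.notMem_empty z hz).elim⟩
  obtain ⟨z₀, hz₀, hmin⟩ :=
    hK.exists_isMinOn hne (continuous_infDist_pt (frontier R.carrier)).continuousOn
  have hpos : 0 < infDist z₀ (frontier R.carrier) := by
    have hne' : (frontier R.carrier).Nonempty := ⟨_, R.boundary_mem_frontier 0⟩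
    rw [← isClosed_frontier.notMem_iff_infDist_pos hne']
    exact fun h => (Set.disjoint_left.1 R.disjoint_carrier_frontier) (hKΩ hz₀) h
  set a : ℝ := infDist z₀ (frontier R.carrier) / 2 with ha
  obtain ⟨ε, hε, harcs⟩ := hG.arcs_close
  have hεsmall : ∀ᶠ δ in 𝓝[>] (0 : ℝ), ε δ < a := hε (Iio_mem_nhds (by positivity))
  refine ⟨a, by positivity, ?_⟩
  filter_upwards [harcs, hεsmall] with δ harcs hεδ z hz j
  refine le_trans ?_ (le_infDist_dropLast_arcPts (fun i => (harcs i).2) z j)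
  have h1 : infDist z (frontier R.carrier) ≤ infDist z ((forgetLast R).arc j) :=
    infDist_le_infDist_of_subset ((forgetLast R).arc_subset_frontier j)
      ⟨_, (forgetLast R).pt_mem_arc_self j⟩
  have h0 : infDist z₀ (frontier R.carrier) ≤ infDist z (frontier R.carrier) := hmin hz
  have h2 : 2 * a ≤ infDist z (frontier R.carrier) := by rw [ha]; linarith
  linarith

/-- **(12) in the compact-set format from a three-arm bound.** If `|g δ i w z_j| ≤ A (δ/a)^α`
(`α > 0`) for every triangle `w` of `G_δ` whose centre is at distance `≥ a > 2000 δ` from one of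
the three discrete arcs (Bollobás–Riordan 2006, (12) p. 181: Claim 10 and Lemma 4), then
`|g| ≤ ε(δ) → 0` on the faces of any compact `K ⊆ Ω`, eventually — with one rate for all `K`,
`ε(δ) = A (2δ/a₀)^α`, `a₀` the constant of (35). [cite: BollobasRiordan2006, Ch. 7 (12) p. 181, (35) p. 197] -/
theorem approxSwitching_small_of_armBound {R : ConformalRectangle} {G : ℝ → TriMarkedDomain 4}
    (hG : IsDiscreteApprox R G) (g : ℝ → Fin 3 → HexVertex → HexVertex → ℝ) {α : ℝ} (hα : 0 < α)
    (A : ℝ)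
    (h : ∀ (δ a : ℝ), 0 < δ → 2000 * δ < a → ∀ w ∈ (G δ).faces,
      (∃ j : Fin 3, a ≤ infDist ((δ : ℂ) * hexCenter w) ((G δ).dropLast.arcPts δ j)) →
        ∀ i j : Fin 3, |g δ i w (oppFace w j)| ≤ A * (δ / a) ^ α) :
    ∃ ε : ℝ → ℝ, Tendsto ε (𝓝[>] 0) (𝓝 0) ∧ ∀ K : Set ℂ, IsCompact K → K ⊆ R.carrier →
      ∀ᶠ δ : ℝ in 𝓝[>] 0, ∀ w : HexVertex, (δ : ℂ) * hexCenter w ∈ K →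
        ∀ i j : Fin 3, |g δ i w (oppFace w j)| ≤ ε δ := by
  obtain ⟨a₀, ha₀, harc⟩ := (forgetLast R).exists_pos_forall_le_infDist_arc
  set a : ℝ := a₀ / 2 with ha
  have hapos : 0 < a := by positivity
  refine ⟨fun δ => A * (δ / a) ^ α, ?_, fun K hK hKΩ => ?_⟩
  · have h1 : Tendsto (fun δ : ℝ => δ / a) (𝓝 0) (𝓝 (0 / a)) := tendsto_id.div_const a
    rw [zero_div] at h1
    have h2 : Tendsto (fun x : ℝ => x ^ α) (𝓝 0) (𝓝 ((0 : ℝ) ^ α)) :=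
      (Real.continuousAt_rpow_const 0 α (Or.inr hα.le)).tendsto
    rw [Real.zero_rpow hα.ne'] at h2
    have h3 := (h2.comp h1).const_mul A
    rw [mul_zero] at h3
    exact h3.mono_left nhdsWithin_le_nhds
  obtain ⟨ε, hε, harcs⟩ := hG.arcs_close
  have hεsmall : ∀ᶠ δ in 𝓝[>] (0 : ℝ), ε δ < a₀ / 2 := hε (Iio_mem_nhds (by positivity))
  have hδsmall : ∀ᶠ δ in 𝓝[>] (0 : ℝ), δ ∈ Ioo 0 (a / 2000) := Ioo_mem_nhdsGT (by positivity)
  filter_upwards [eventually_mem_faces_of_isDiscreteApprox hG hK hKΩ, harcs, hεsmall, hδsmall] with δ hfaces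
    harcs hεδ hδ w hw i j
  refine h δ a hδ.1 (by linarith [hδ.2]) w (hfaces w hw) ?_ i j
  obtain ⟨k, hk⟩ := harc ((δ : ℂ) * hexCenter w)
  refine ⟨k, le_trans ?_ (le_infDist_dropLast_arcPts (fun i => (harcs i).2) _ k)⟩
  rw [ha]; linarith

/-- **(14≈) in the compact-set format from a colour-switching defect with a rate.** If the
colour-switching defect at a triangle `w` of `G_δ` whose centre keeps distance `≥ a` from all
three discrete arcs is at most `η(a, δ)` with `η(a, δ)/δ → 0` as `δ → 0⁺` for each `a > 0` (the
format in which a mesoscopic colour-switching estimate is naturally proved), then the defect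
is `≤ η_K(δ) = o(δ)` on the faces of any compact `K ⊆ Ω`, eventually. [cite: BollobasRiordan2006, Ch. 7 (14) p. 181] -/
theorem approxSwitching_defect_of_rate {R : ConformalRectangle} {G : ℝ → TriMarkedDomain 4}
    (hG : IsDiscreteApprox R G) (g : ℝ → Fin 3 → HexVertex → HexVertex → ℝ) (η : ℝ → ℝ → ℝ)
    (hη : ∀ a, 0 < a → Tendsto (fun δ => η a δ / δ) (𝓝[>] 0) (𝓝 0))
    (h : ∀ (δ a : ℝ), 0 < δ → 0 < a → ∀ w ∈ (G δ).faces,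
      (∀ j : Fin 3, a ≤ infDist ((δ : ℂ) * hexCenter w) ((G δ).dropLast.arcPts δ j)) →
        ∀ i j : Fin 3, |g δ (i + 1) w (oppFace w (j + 1)) - g δ i w (oppFace w j)| ≤ η a δ) :
    ∀ K : Set ℂ, IsCompact K → K ⊆ R.carrier → ∃ η' : ℝ → ℝ,
      Tendsto (fun δ => η' δ / δ) (𝓝[>] 0) (𝓝 0) ∧
      ∀ᶠ δ : ℝ in 𝓝[>] 0, ∀ w : HexVertex, (δ : ℂ) * hexCenter w ∈ K →
        ∀ i j : Fin 3, |g δ (i + 1) w (oppFace w (j + 1)) - g δ i w (oppFace w j)| ≤ η' δ := by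
  intro K hK hKΩ
  obtain ⟨a, ha, hfar⟩ := eventually_le_infDist_arcPts_of_isDiscreteApprox hG hK hKΩ
  refine ⟨η a, hη a ha, ?_⟩
  filter_upwards [eventually_mem_faces_of_isDiscreteApprox hG hK hKΩ, hfar, self_mem_nhdsWithin] with δ hfaces
    hfar hδ w hw i j
  exact h δ a hδ ha w (hfaces w hw) (hfar _ hw) i j

/-- **The estimate of p. 198 in the qualitative format from its quantitative form.** If
`F(z') - F(w') ≤ 2 (3γ/(c/2))^α` (`α > 0`) whenever every point of the plane is at distance
`≥ c` from one of the three discrete arcs, `12γ ≤ c`, `1000δ ≤ 3γ`, and `z'` is reached from the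
triangle `w'` of `G_δ` by a dual chain of triangles of `G_δ` inside `B_{2γ}(w')`
(Bollobás–Riordan 2006, p. 198, the format of `tri_sepProb_sub_le_of_dualPath`), then for every
`β > 0` some `γ > 0` achieves `F(z') - F(w') ≤ β` along such chains, eventually.
[cite: BollobasRiordan2006, Ch. 7 proof of Claim 22 p. 198, (35) p. 197] -/
theorem approxSwitching_equi_of_dualPath {R : ConformalRectangle} {G : ℝ → TriMarkedDomain 4}
    (hG : IsDiscreteApprox R G) (F : ℝ → Fin 3 → HexVertex → ℝ) {α : ℝ} (hα : 0 < α)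
    (h : ∀ (δ c γ : ℝ), 0 < δ → 0 < γ → 12 * γ ≤ c → 1000 * δ ≤ 3 * γ →
      (∀ w : ℂ, ∃ j : Fin 3, c ≤ infDist w ((G δ).dropLast.arcPts δ j)) →
        ∀ (i : Fin 3) (w' z' : HexVertex), w' ∈ (G δ).faces →
          Relation.ReflTransGen (fun x y : HexVertex => hexGraph.Adj x y ∧ y ∈ (G δ).faces ∧
            dist ((δ : ℂ) * hexCenter w') ((δ : ℂ) * hexCenter y) < 2 * γ) w' z' →
            F δ i z' - F δ i w' ≤ 2 * (3 * γ / (c / 2)) ^ α) :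
    ∀ β > (0 : ℝ), ∃ γ > (0 : ℝ), ∀ᶠ δ : ℝ in 𝓝[>] 0, ∀ (i : Fin 3) (w z : HexVertex),
      w ∈ (G δ).faces → Relation.ReflTransGen (fun x y : HexVertex => hexGraph.Adj x y ∧
        y ∈ (G δ).faces ∧ dist ((δ : ℂ) * hexCenter w) ((δ : ℂ) * hexCenter y) < 2 * γ) w z →
        F δ i z - F δ i w ≤ β := by
  intro β hβ
  obtain ⟨a₀, ha₀, harc⟩ := (forgetLast R).exists_pos_forall_le_infDist_arc
  set c : ℝ := a₀ / 2 with hc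
  have hcpos : 0 < c := by positivity
  obtain ⟨γ, hγ, hγc, hγβ⟩ : ∃ γ > (0 : ℝ), 12 * γ ≤ c ∧ 2 * (3 * γ / (c / 2)) ^ α < β := by
    have ht : Tendsto (fun γ : ℝ => 2 * (3 * γ / (c / 2)) ^ α) (𝓝[>] 0) (𝓝 0) := by
      have h1 : Tendsto (fun γ : ℝ => 3 * γ / (c / 2)) (𝓝 0) (𝓝 (3 * 0 / (c / 2))) :=
        ((tendsto_id.const_mul 3).div_const _)
      rw [mul_zero, zero_div] at h1
      have h2 : Tendsto (fun x : ℝ => x ^ α) (𝓝 0) (𝓝 ((0 : ℝ) ^ α)) :=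
        (Real.continuousAt_rpow_const 0 α (Or.inr hα.le)).tendsto
      rw [Real.zero_rpow hα.ne'] at h2
      have h3 := (h2.comp h1).const_mul 2
      rw [mul_zero] at h3
      exact h3.mono_left nhdsWithin_le_nhds
    have hev := (ht.eventually (gt_mem_nhds hβ)).and
      (Ioc_mem_nhdsGT (show (0 : ℝ) < c / 12 by positivity))
    obtain ⟨γ, hγβ, hγ⟩ := hev.exists
    exact ⟨γ, hγ.1, by linarith [hγ.2], hγβ⟩
  obtain ⟨ε, hε, harcs⟩ := hG.arcs_close
  have hεsmall : ∀ᶠ δ in 𝓝[>] (0 : ℝ), ε δ < a₀ / 2 := hε (Iio_mem_nhds (by positivity))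
  have hδsmall : ∀ᶠ δ in 𝓝[>] (0 : ℝ), δ ∈ Ioc 0 (3 * γ / 1000) := Ioc_mem_nhdsGT (by positivity)
  refine ⟨γ, hγ, ?_⟩
  filter_upwards [harcs, hεsmall, hδsmall] with δ harcs hεδ hδ i w z hw hwz
  have h35 : ∀ u : ℂ, ∃ j : Fin 3, c ≤ infDist u ((G δ).dropLast.arcPts δ j) := by
    intro u
    obtain ⟨j, hj⟩ := harc u
    refine ⟨j, le_trans ?_ (le_infDist_dropLast_arcPts (fun i => (harcs i).2) u j)⟩
    rw [hc]; linarith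
  have h' := h δ c γ hδ.1 hγ hγc (by linarith [hδ.2]) h35 i w z hw hwz
  linarith

/-! ### The sandwich: the hypothesis of `SeparatingDataToCardy` for one Carleson datum -/

/-- **Two systems of separating data sandwiching a crossing-probability function** (Bollobás–
Riordan 2006, p. 203: "`P_δ(G_δ⁻) = f²_δ(z_δ) + o(1)`" with (19)
`P_δ(G_δ⁻) - o(1) ≤ P_δ(D₄) ≤ P_δ(G_δ⁺) + o(1)`): given separating data reading the face values
`F⁻`, `F⁺` of two discrete approximations `G⁻`, `G⁺` (as produced by
`exists_isSeparatingData_of_approxSwitching`) and triangles `z∓_δ` of `G∓_δ` with centres in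
`Ω` tending to `d' = R.pt 3` such that `F⁻_δ¹(z⁻_δ) - e(δ) ≤ Q(δ) ≤ F⁺_δ¹(z⁺_δ) + e(δ)`
eventually, `e → 0`, one has literally the datum-wise hypothesis of the route item
`SeparatingDataToCardy` (with `Q` in place of the bond-𝕋 crossing probability at mesh `δ/√3`).
[cite: BollobasRiordan2006, Ch. 7 proof of Thm. 2 p. 203, (19) p. 184, (40) p. 201] -/
theorem exists_separatingData_sandwich {R : ConformalRectangle} {ω : ℂ}
    {Gm Gp : ℝ → TriMarkedDomain 4} {Fm Fp : ℝ → Fin 3 → HexVertex → ℝ}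
    (hm : ∃ f : ℝ → Fin 3 → ℂ → ℝ, (∀ δ, δ ≠ 0 → ∀ i w, f δ i ((δ : ℂ) * hexCenter w) = Fm δ i w) ∧
      IsSeparatingData R ω (fun δ => ((Gm δ).faces).image fun w => (δ : ℂ) * hexCenter w) f)
    (hp : ∃ f : ℝ → Fin 3 → ℂ → ℝ, (∀ δ, δ ≠ 0 → ∀ i w, f δ i ((δ : ℂ) * hexCenter w) = Fp δ i w) ∧
      IsSeparatingData R ω (fun δ => ((Gp δ).faces).image fun w => (δ : ℂ) * hexCenter w) f)
    {zm zp : ℝ → HexVertex} {e Q : ℝ → ℝ}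
    (hzm : ∀ᶠ δ : ℝ in 𝓝[>] 0, zm δ ∈ (Gm δ).faces ∧ (δ : ℂ) * hexCenter (zm δ) ∈ R.carrier)
    (hzp : ∀ᶠ δ : ℝ in 𝓝[>] 0, zp δ ∈ (Gp δ).faces ∧ (δ : ℂ) * hexCenter (zp δ) ∈ R.carrier)
    (hztm : Tendsto (fun δ : ℝ => (δ : ℂ) * hexCenter (zm δ)) (𝓝[>] 0) (𝓝 (R.pt 3)))
    (hztp : Tendsto (fun δ : ℝ => (δ : ℂ) * hexCenter (zp δ)) (𝓝[>] 0) (𝓝 (R.pt 3)))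
    (he : Tendsto e (𝓝[>] 0) (𝓝 0))
    (hsand : ∀ᶠ δ : ℝ in 𝓝[>] 0, Fm δ 1 (zm δ) - e δ ≤ Q δ ∧ Q δ ≤ Fp δ 1 (zp δ) + e δ) :
    ∃ (Sm Sp : ℝ → Finset ℂ) (fm fp : ℝ → Fin 3 → ℂ → ℝ),
      IsSeparatingData R ω Sm fm ∧ IsSeparatingData R ω Sp fp ∧
        ∃ (zm zp : ℝ → ℂ) (e : ℝ → ℝ),
          (∀ᶠ δ in 𝓝[>] (0 : ℝ),
              zm δ ∈ Sm δ ∧ zm δ ∈ R.carrier ∧ zp δ ∈ Sp δ ∧ zp δ ∈ R.carrier) ∧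
            Tendsto zm (𝓝[>] 0) (𝓝 (R.pt 3)) ∧ Tendsto zp (𝓝[>] 0) (𝓝 (R.pt 3)) ∧
              Tendsto e (𝓝[>] 0) (𝓝 0) ∧
                ∀ᶠ δ in 𝓝[>] (0 : ℝ), fm δ 1 (zm δ) - e δ ≤ Q δ ∧ Q δ ≤ fp δ 1 (zp δ) + e δ := by
  obtain ⟨fm, hfm, hDm⟩ := hm
  obtain ⟨fp, hfp, hDp⟩ := hp
  have hpos : ∀ᶠ δ in 𝓝[>] (0 : ℝ), δ ≠ 0 :=
    (eventually_mem_nhdsWithin).mono fun δ hδ => ne_of_gt hδ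
  refine ⟨_, _, fm, fp, hDm, hDp, fun δ => (δ : ℂ) * hexCenter (zm δ),
    fun δ => (δ : ℂ) * hexCenter (zp δ), e, ?_, hztm, hztp, he, ?_⟩
  · filter_upwards [hzm, hzp] with δ hm' hp'
    exact ⟨Finset.mem_image_of_mem _ hm'.1, hm'.2, Finset.mem_image_of_mem _ hp'.1, hp'.2⟩
  · filter_upwards [hsand, hpos] with δ hδ hδ0
    rw [hfm δ hδ0, hfp δ hδ0]
    exact hδ

/-! ### Specialisation to the Chayes–Lei separating probabilities -/

/-- **Separating data for a Chayes–Lei hexagon model from approximate colour switching.** For a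
hexagon model `M` on the sites of `𝕋` (`clHexPercolation M`; for critical bond percolation on `𝕋`
take `M = ChayesLeiHexPercolation.triBondCritical`) and a discrete approximation `G_δ` of `R`,
let `fⁱ_δ = clSepProb` and `hⁱ_δ = clSepDiffProb` be the Bollobás–Riordan separating
probabilities of the 3-marked domains `(G δ).dropLast` for yellow paths with half-edge
connectivity (`ChayesLeiHex`). Then (10) holds exactly (`clSepProb_sub_clSepProb`) and
`0 ≤ f ≤ 1`, so the four percolation estimates — (12) three-arm smallness of `h` on compacta,
(14≈) the mesoscopic colour-switching defect `o(δ)` on compacta, the equicontinuity estimate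
of p. 198 and the boundary values of pp. 200–201 — yield discrete separating data with
`ω = ζ²` reading `clSepProb` at the face centres (`exists_isSeparatingData_of_approxSwitching`).
[cite: BollobasRiordan2006, Ch. 7 §7.2.6 pp. 196–201] -/
theorem exists_isSeparatingData_clSepProb_of_approxSwitching (M : ChayesLeiHexPercolation)
    {R : ConformalRectangle} {G : ℝ → TriMarkedDomain 4} (hG : IsDiscreteApprox R G)
    (h12 : ∀ K : Set ℂ, IsCompact K → K ⊆ R.carrier → ∃ ε : ℝ → ℝ, Tendsto ε (𝓝[>] 0) (𝓝 0) ∧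
      ∀ᶠ δ : ℝ in 𝓝[>] 0, ∀ w : HexVertex, (δ : ℂ) * hexCenter w ∈ K →
        ∀ i j : Fin 3, (G δ).dropLast.clSepDiffProb M i w (oppFace w j) ≤ ε δ)
    (h14 : ∀ K : Set ℂ, IsCompact K → K ⊆ R.carrier → ∃ η : ℝ → ℝ,
      Tendsto (fun δ => η δ / δ) (𝓝[>] 0) (𝓝 0) ∧
      ∀ᶠ δ : ℝ in 𝓝[>] 0, ∀ w : HexVertex, (δ : ℂ) * hexCenter w ∈ K → ∀ i j : Fin 3,
        |(G δ).dropLast.clSepDiffProb M (i + 1) w (oppFace w (j + 1)) -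
            (G δ).dropLast.clSepDiffProb M i w (oppFace w j)| ≤ η δ)
    (h198 : ∀ β > (0 : ℝ), ∃ γ > (0 : ℝ), ∀ᶠ δ : ℝ in 𝓝[>] 0, ∀ (i : Fin 3) (w z : HexVertex),
      w ∈ (G δ).faces → Relation.ReflTransGen (fun x y : HexVertex => hexGraph.Adj x y ∧
        y ∈ (G δ).faces ∧ dist ((δ : ℂ) * hexCenter w) ((δ : ℂ) * hexCenter y) < 2 * γ) w z →
        (G δ).dropLast.clSepProb M i z - (G δ).dropLast.clSepProb M i w ≤ β)
    (h200 : ∀ (i : Fin 3), ∀ z ∈ (forgetLast R).boundary ''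
        Ioo ((forgetLast R).mark i) ((forgetLast R).nextMark i),
      ∃ zs : ℝ → HexVertex,
        (∀ᶠ δ in 𝓝[>] (0 : ℝ), zs δ ∈ (G δ).faces ∧ (δ : ℂ) * hexCenter (zs δ) ∈ R.carrier) ∧
          Tendsto (fun δ : ℝ => (δ : ℂ) * hexCenter (zs δ)) (𝓝[>] 0) (𝓝 z) ∧
            Tendsto (fun δ => (G δ).dropLast.clSepProb M i (zs δ)) (𝓝[>] 0) (𝓝 0) ∧
              Tendsto (fun δ => (G δ).dropLast.clSepProb M (i + 1) (zs δ) +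
                (G δ).dropLast.clSepProb M (i + 2) (zs δ)) (𝓝[>] 0) (𝓝 1)) :
    ∃ f : ℝ → Fin 3 → ℂ → ℝ,
      (∀ δ, δ ≠ 0 → ∀ i w, f δ i ((δ : ℂ) * hexCenter w) = (G δ).dropLast.clSepProb M i w) ∧
        IsSeparatingData R triOmega (fun δ => ((G δ).faces).image fun w => (δ : ℂ) * hexCenter w) f := by
  refine exists_isSeparatingData_of_approxSwitching hG (fun δ i w => (G δ).dropLast.clSepProb M i w)
    (fun δ i w z => (G δ).dropLast.clSepDiffProb M i w z)
    (fun δ i w => ⟨MeasureTheory.measureReal_nonneg, MeasureTheory.measureReal_le_one⟩)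
    (fun δ _ i w j => (G δ).dropLast.clSepProb_sub_clSepProb M i w (oppFace w j))
    (fun K hK hKΩ => ?_) h14 h198 h200
  obtain ⟨ε, hε, h⟩ := h12 K hK hKΩ
  refine ⟨ε, hε, h.mono fun δ hδ w hw i j => ?_⟩
  have h0 : 0 ≤ (G δ).dropLast.clSepDiffProb M i w (oppFace w j) := MeasureTheory.measureReal_nonneg
  rw [abs_of_nonneg h0]
  exact hδ w hw i j

end Summit.CriticalPhenomena.CardyFormulaZ2.Theorems

end
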